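import Literature.MathematicalPhysics.QuantumFieldTheory.Balaban1983to89.B4GaugeCovariance

/-!
# `Balaban1983to89.B4GaussRep36` — B4 §3 "Proof of Proposition 2.3 of [1]": the Gaussian representation
# (3.1)–(3.8) of the unit-lattice propagators `C^{(k)}_Λ(Ω, A)`, the two-scale propagator `G_k(Ω, Λ, A)` (3.5),
# the resolvent identity (3.9) and the estimate (3.10) — TYPED SKELETON (statement level), with the finite-dimensional
# algebra kernel-checked where it is elementary

Statement-level skeleton of published theorems with citation tags; proofs where landed; nothing here is a claim about
the Yang–Mills mass gap.

**Source.** T. Bałaban, *Regularity and decay of lattice Green's functions*, Commun. Math. Phys. **89** (1983) 571–597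
[Balaban1983RegularityDecay] (cell index B4), §3, pp. 586–589 [PDF 16–19] (journal page = PDF page + 570); read from the
page renders `run/shared/lean/pub/pub-balaban/b2b-balaban-ref1/pages/1983-cmp89-regularity-decay/…-p017-x2.png`,
`…-p018-x2.png` and the verbatim transcript `run/shared/lean/pub/pub-balaban/b2b-balaban-b04/transcript-B4.md`.
Cell `lit-balaban` (mega-formalization of Bałaban CMP 1983–89), unit `lit-balaban-r01` (reader/typer of CMP 89).
This module EXTENDS the `B4*` family: §3 is the one section of the paper of which no display was typed before
(`B4.lean` types "Proposition 2.3 of [1]" = `B4.Prop23Printed` and quotes §3 only in docstrings; `B4TwoScaleForm`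
certifies the quadratic-form core (2.26)–(2.29) for the two-scale operator of (3.5) at `A = 0`).  Nothing of `B4`,
`B4GaugeCovariance`, `B4TwoScaleForm` is restated; the operators (1.3)–(1.6) WITH gauge field are those of
`B4GaugeCovariance` (`covLap`, `avgOp`, `projOp`, `covOp`, `green`), see `kForm_covOp`.

## The print (verbatim from the renders; `⟦…⟧` = reading notes)

p. 586 [PDF 16]: «3. Proof of Proposition 2.3 of [1]. The proof will be based on explicit representation for the
propagators C^{(k)}_Λ(Ω,A) in terms of G_k(Ω,A) or related propagators. We have the following equality
C^{(k)}_Λ(Ω,A;y,y') = ((Δ^{(k)}(Ω,A) + aL^{−2}P(A))|_Λ)^{−1}(y,y') = (Z^{(k)}_Λ(Ω,A))^{−1}∫dψ|_Λ (aL^{d−2}/2π)^{N|Λ'|/2}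
exp[−½aL^{d−2}Σ_{z∈Λ'}|(Q(A)ψ)(z)|² − ½⟨ψ,Δ^{(k)}(Ω,A)ψ⟩]ψ(y)ψ*(y') = …» (3.1) ⟦continued p. 587 with the joint
Gaussian integral over `(ψ|_Λ, φ|_Ω)` with exponent `−½aL^{d−2}Σ_{z∈Λ'}|(Q(A)ψ)(z)|² − ½a_kΣ_{y∈Ω^{(k)}}|(Λψ)(y) −
(Q_k(A)φ)(y)|² − ½⟨φ,(−Δ^{η,N}_{A,Ω} + m_k²)φ⟩` and the translation `ψ → ψ + Q_k(A)φ` on `Λ`⟧.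
p. 587 [PDF 17]: «We apply the general formula
∫Π_{j=1}^N dx_j{1, x_j, x_jx_k} exp[−½A(Σ_{j=1}^N x_j)² − ½BΣ_{j=1}^N x_j² + CΣ_{j=1}^N x_j]
 = {1, C/(NA+B), (C/(NA+B))² − A/(B(NA+B)) + δ_{j,k}/B}·(2π)^{N/2}((NA+B)B^{N−1})^{−1/2}exp(½NC²/(NA+B)), (3.3)
and using the recursive relation a_{k+1} = aa_k/(aL^{−2} + a_k), we get» (3.4) «… Z is of course a normalization
factor. Denoting
G_k(Ω,Λ,A) = (−Δ^{η,N}_{A,Ω} + m_k² + a_kP_k(A)(Ω∖B^k(Λ)) + a_{k+1}L^{−2}P_{k+1}(A)B^k(Λ))^{−1}, (3.5)»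
p. 588 [PDF 18]: «we have finally
C^{(k)}_Λ(Ω,A;y,y') = ([−(a_{k+1}/a_k)L^{−2}Q*(A)Q_{k+1}(A) + Q_k(A)]G_k(Ω,Λ,A)
 ·[−(a_{k+1}/a_k)L^{−2}Q*_{k+1}(A)Q(A) + Q*_k(A)])(y,y') − (a_{k+1}/a_k²)L^{−2}P(A;y,y') + δ_{y,y'}/a_k. (3.6)
A composition of an operator T defined on the η-lattice with Q*_k(A) or Q*_{k+1}(A)Q(A) can be interpreted as the
action of the operator T on properly defined functions on the η-lattice. More exactly if we define the functions
q_k(y), q_{k+1}(y) by the formulas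
q_k(y,x) = a column of U(A(Γ^{(k)}_{x,y})) for x∈B^k(y), 0 otherwise,
q_{k+1}(y,x) = a column of L^{−d}U(A(Γ^{(k+1)}_{x,z}∪Γ_{z,y})) for x∈B^{k+1}(z), z such that y∈B(z), 0 otherwise, (3.7)
then we have
C^{(k)}_Λ(Ω,A;y,y') = ⟨−(a_{k+1}/a_k)L^{−2}q_{k+1}(y) + q_k(y), G_k(Ω,Λ,A)(−(a_{k+1}/a_k)L^{−2}q_{k+1}(y') + q_k(y'))⟩
 − (a_{k+1}/a_k²)L^{−2}P(A;y,y') + δ_{y,y'}/a_k. (3.8)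
The L²-norms of the functions q_k(y), q_{k+1}(y) are equal to 1, L^{−d/2} and their supports are in B^k(y),
B^{k+1}(z(y)) respectively, so the inequalities (1.11), (1.12), and (1.16) ⟦= (1.15), (1.16), (1.20): every in-text
reference to a §1 display in B4 is low by four, cell census⟧ are simple consequences of Corollary 2.3. […] Now to
prove the inequality (1.14) ⟦= (1.18)⟧ we have to estimate the difference G_k(Ω,Λ,A) − G^η_{k+1}(Ω,A). This is easy
because on the basis of (3.5) we have
G_k(Ω,Λ,A) − G^η_{k+1}(Ω,A) = G_k(Ω,Λ,A)[a_kP_k(A) − a_{k+1}L^{−2}P_{k+1}(A)](Ω∖B^k(Λ))G^η_{k+1}(Ω,A), (3.9)»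
p. 589 [PDF 19]: «and for f, f' ∈ L²(B^k(Λ)), we get
|⟨f,(G_k(Ω,Λ,A) − G^η_{k+1}(Ω,A))f'⟩| ≤ c₀‖f‖₂‖f'‖₂·exp[−δ₀(dist(supp f,supp f') + dist(supp f,B^k(Λ^c))
 + dist(supp f',B^k(Λ^c)))]. (3.10)
The function δC^{(k)}_Λ(Ω,A) is given by (3.8) with the operator (3.9) instead of G_k(Ω,Λ,A) and the inequality (3.10)
implies (1.14) ⟦(1.18)⟧. This ends the proof of Proposition I.2.3.»

## DICTIONARY (print ↦ Lean; all pairings PLAIN, the printed weights absorbed — the convention of `B4GaugeCovariance`)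

* Sites: finite index types `X` (the η-lattice sites of `Ω` TIMES the colour index, `ℝ^N`-valued fields folded into
  the index), `Y` (`Ω^{(k)} = Ω ∩ ℤ^d`, times colours), `Z` (`Ω^{(k+1)}`, the `L`-lattice, times colours).
* `H : Matrix X X ℝ` = the PLAIN matrix of the form `⟨φ,(−Δ^{η,N}_{A,Ω} + m_k²)φ⟩` (`= φᵀHφ`; with [B4]'s `η^d`-weighted
  pairing this is `η^d` times the operator matrix) — e.g. `B4GaugeCovariance.covLap c W + m2 • 1`; only `Hᵀ = H` is used.
* `Qk : Matrix Y X ℝ` = the averaging operator (1.4) AS A PLAIN MATRIX, entries `η^d·U(A(Γ^{(k)}_{y,x}))·1[x ∈ B^k(y)]`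
  (`B4GaugeCovariance.avgOp q T`); then [B4]'s adjoint `Q_k^*` (η-weighted ↔ plain) is `η^{−d}Qkᵀ`, `⟨φ, P_kφ⟩ = |Qkφ|²`,
  and the covariance KERNEL `G_k(Ω,A;x,x')` of (1.6) is the plain inverse `(H + a_k QkᵀQk)⁻¹ (x,x')` (`kForm`, `gk`).
* `Q : Matrix Z Y ℝ` = the next-level `L`-block averaging `(Qψ)(z) = Σ_{y∈B(z)} L^{−d}U(A(Γ_{z,y}))ψ(y)` as a plain
  matrix; `w = L^d` is the weight of the `L`-lattice pairing, so `Q^* = w·Qᵀ`, `P(A) = Q^*Q = w·QᵀQ` (`pOp`), and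
  `aL^{−2}⟨ψ,P(A)ψ⟩ = aL^{d−2}Σ_z|(Qψ)(z)|²` as in (3.1); `ℓ = L^{−2}`; `Q_{k+1}(A) = Q(A)Q_k(A)` (`qNext`, the
  composition rule of the block averages of [1], used by (3.1) line 2).  The only structure of `Q` the identity (3.6)
  needs: `QQᵀ = w⁻¹·1` (`RowOrtho`: the rows `L^{−d}U(A(Γ_{z,·}))` are orthogonal with squared norm `L^{−d}`, the `U`
  being orthogonal) and "no `L`-block straddles `∂Λ`" (`BlockCompatible Q Λ Λ'`: `Λ = B(Λ')`, i.e. «Λ being a sum of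
  big blocks» p. 574 with `Λ' = Λ ∩ LZ^d`).
* `Δ^{(k)}(Ω,A) = a_kI − a_k²Q_k(A)G_k(Ω,A)Q_k^*(A)` (1.14) ↦ `deltaK H ak Qk = a_k•1 − a_k²•(Qk (H + a_kQkᵀQk)⁻¹ Qkᵀ)`
  (plain on `Y`; the `η^{±d}` of `G_k` as an operator and of `Q_k^*` cancel); `(X)|_Λ = ΛXΛ` ↦ `submatrix` to `↥Λ`;
  `C^{(k)}_Λ(Ω,A) = ((Δ^{(k)} + aL^{−2}P(A))|_Λ)⁻¹` (1.13) ↦ `cLam`; `G_k(Ω,Λ,A)` (3.5) ↦ `gLam = (kLam …)⁻¹` with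
  `kLam = H + a_k•QkᵀD_{Λᶜ}Qk + (a_{k+1}wℓ)•Q_{k+1}ᵀD_{Λ'}Q_{k+1}` (`D_S` = `diagInd S`; `a_kP_k(A)(Ω∖B^k(Λ))` =
  the unit blocks outside `Λ`, `a_{k+1}L^{−2}P_{k+1}(A)B^k(Λ)` = the `L`-blocks inside `Λ`, `⟨φ,P_{k+1}φ⟩ = w|Q_{k+1}φ|²`);
  `G^η_{k+1}(Ω,A)` of (3.9) = the case `Λ = Ω^{(k)}` of (3.5) ↦ `gNext = gLam … univ univ`; `a_{k+1}` ↦ `aNext a ak ℓ`.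
* (3.6)'s operator `[−(a_{k+1}/a_k)L^{−2}Q^*Q_{k+1} + Q_k]` restricted to rows `y ∈ Λ` ↦ `tOp` (`Q^* = wQᵀ`); its rows
  ARE the functions `−(a_{k+1}/a_k)L^{−2}q_{k+1}(y) + q_k(y)` of (3.7)–(3.8) read as plain vectors (`qk`, `qk1`, `eq38`).

## What is typed / what is proved (HONEST SCOPE)

TYPED (statement level, `def … : Prop`, proof deferred to Phase 2 of the cell): `Rep36` = the representation (3.6)
as an identity of real matrices under the hypotheses that make both sides meaningful (`H` symmetric; `a_k, a, L^d,
L^{−2} > 0`; `RowOrtho`; `BlockCompatible`; `G_k(Ω,A)` and `G_k(Ω,Λ,A)` exist as inverses of positive definite forms —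
(1.8)); `Gauss33` = the Gaussian formula (3.3) as three integrals over `ℝ^N`; `GaussCovariance` = the folklore content
of (3.1)/(3.4) "covariance of a centred Gaussian density = inverse of its precision matrix"; `Ineq310` = (3.10) over the
printed functionals.  PROVED (kernel): the algebraic core of (3.3) (`gauss33_inv`: `(A·𝟙𝟙ᵀ + B·1)⁻¹ =
B⁻¹(1 − A/(NA+B)·𝟙𝟙ᵀ)`, `gauss33_mean`); (3.8) ⇔ (3.6) entrywise (`eq38`); the resolvent identity behind (3.9) with
the CORRECT SIGN (`eq39`): `G_k(Ω,Λ,A) − G^η_{k+1}(Ω,A) = −G_k(Ω,Λ,A)[a_kP_k − a_{k+1}L^{−2}P_{k+1}](Ω∖B^k(Λ))G^η_{k+1}(Ω,A)`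
— the print (3.9) omits the overall minus sign (`A⁻¹ − B⁻¹ = A⁻¹(B − A)B⁻¹` with `B − A = −[a_kP_k −
a_{k+1}L^{−2}P_{k+1}](Ω∖B^k(Λ))`); harmless for (3.10), which bounds an absolute value (cell record: lit-balaban
HOME `lit-balaban-r01/CENSUS-r01.md` E-B4-39; numerical witness `scratch/check36.py` of the seat); the dictionary lemma
`kForm_covOp`.  NOT typed here: the Gaussian-integral manipulations (3.1)–(3.2), (3.4) themselves (their content is
`GaussCovariance` + `Gauss33` + `Rep36`); the sentence "so the inequalities (1.15), (1.16), (1.20) are simple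
consequences of Corollary 2.3" (census G-B4-04 of the audit cell: Cor. 2.3 for `G_k(Ω,Λ,A)` is asserted "with only
slight changes") — its conclusion is `B4.Prop23Printed`, proved at `A = 0` in `B4Prop23ZeroBox/ZeroRegion`,
`B4RegionCov1518`, `B4Ineq118Torus`.  No statement of the series is asserted; every `def … : Prop` below is consumed
only as a hypothesis.
-/

namespace Literature.MathematicalPhysics.QuantumFieldTheory.Balaban1983to89.B4GaussRep36

open Matrix Finset

/-! ## §0. The Gaussian formulas (3.1)/(3.4) (folklore content) and (3.3) -/

section Gauss

open MeasureTheory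

/-- The folklore fact behind (3.1) and (3.4) (p. 586–587 [PDF 16–17]): for a positive definite symmetric real matrix
`M`, the centred Gaussian density `exp(−½xᵀMx)` on `ℝ^n` has second moments `∫x_ix_j e^{−½xᵀMx}dx / ∫e^{−½xᵀMx}dx =
(M⁻¹)_{ij}` — this is how the paper passes from `C^{(k)}_Λ(Ω,A) = ((Δ^{(k)}(Ω,A) + aL^{−2}P(A))|_Λ)^{−1}` to the Gaussian
integral (3.1) and back from (3.4) to (3.6); (3.1), first equality, AS PRINTED is this statement for `M = (Δ^{(k)}(Ω,A) +
aL^{−2}P(A))|_Λ`.  Typed as a statement (Phase 1). [cite: Balaban1983RegularityDecay, (3.1) p.586] -/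
def GaussCovariance (n : Type) [Fintype n] [DecidableEq n] : Prop :=
  ∀ (M : Matrix n n ℝ), M.PosDef → ∀ i j : n,
    (∫ x : n → ℝ, x i * x j * Real.exp (-(1 / 2 : ℝ) * (x ⬝ᵥ (M *ᵥ x)))) =
      M⁻¹ i j * ∫ x : n → ℝ, Real.exp (-(1 / 2 : ℝ) * (x ⬝ᵥ (M *ᵥ x)))

/-- **(3.3)** (p. 587 [PDF 17], verbatim): *"We apply the general formula
∫Π_{j=1}^N dx_j{1, x_j, x_jx_k} exp[−½A(Σ_{j=1}^N x_j)² − ½BΣ_{j=1}^N x_j² + CΣ_{j=1}^N x_j]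
= {1, C/(NA+B), (C/(NA+B))² − A/(B(NA+B)) + δ_{j,k}/B}·(2π)^{N/2}((NA+B)B^{N−1})^{−1/2}exp(½NC²/(NA+B)), (3.3)"*.
Hypotheses made explicit: the quadratic form is positive definite, i.e. `B > 0` and `NA + B > 0` (its eigenvalues are
`NA + B`, once, and `B`, `N − 1` times); `N ≥ 1`.  The three members are typed as three integral identities over
`ℝ^N = Fin N → ℝ` with the common factor `Z`. [cite: Balaban1983RegularityDecay, (3.3) p.587] -/
def Gauss33 (N : ℕ) (A B C : ℝ) : Prop :=
  1 ≤ N → 0 < B → 0 < (N : ℝ) * A + B →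
    let w : (Fin N → ℝ) → ℝ := fun x =>
      Real.exp (-(A / 2) * (∑ j, x j) ^ 2 - (B / 2) * ∑ j, x j ^ 2 + C * ∑ j, x j)
    let Z : ℝ := (2 * Real.pi) ^ ((N : ℝ) / 2) * (((N : ℝ) * A + B) * B ^ (N - 1)) ^ (-(1 / 2 : ℝ)) *
      Real.exp ((N : ℝ) * C ^ 2 / (2 * ((N : ℝ) * A + B)))
    (∫ x, w x = Z) ∧
    (∀ j : Fin N, ∫ x, x j * w x = C / ((N : ℝ) * A + B) * Z) ∧
    (∀ j k : Fin N, ∫ x, x j * x k * w x =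
      ((C / ((N : ℝ) * A + B)) ^ 2 - A / (B * ((N : ℝ) * A + B)) + (if j = k then 1 / B else 0)) * Z)

/-- The all-ones matrix `𝟙𝟙ᵀ` — the matrix of the quadratic form `(Σ_j x_j)²` appearing in the exponent of (3.3)
(API for (3.3)). [cite: Balaban1983RegularityDecay, (3.3) p.587] -/
def onesMat (ι : Type*) : Matrix ι ι ℝ := Matrix.of fun _ _ => 1

/-- `(𝟙𝟙ᵀ)² = N·𝟙𝟙ᵀ` — elementary API for the (3.3) Gaussian (helper for `gauss33_inv`).
[cite: Balaban1983RegularityDecay, (3.3) p.587] -/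
private theorem onesMat_mul_onesMat {ι : Type*} [Fintype ι] :
    onesMat ι * onesMat ι = (Fintype.card ι : ℝ) • onesMat ι := by
  ext i j
  simp [onesMat, Matrix.mul_apply]

/-- KERNEL-CHECKED algebraic core of **(3.3)**: the precision matrix `A·𝟙𝟙ᵀ + B·1` of the Gaussian in (3.3) has
inverse `B⁻¹(1 − (A/(NA+B))·𝟙𝟙ᵀ)`, whose entries `−A/(B(NA+B)) + δ_{jk}/B` are the printed covariances (third member
of (3.3) minus the square of the mean). [cite: Balaban1983RegularityDecay, (3.3) p.587] -/
theorem gauss33_inv {ι : Type*} [Fintype ι] [DecidableEq ι] (A B : ℝ) (hB : B ≠ 0) (hNB : (Fintype.card ι : ℝ) * A + B ≠ 0) :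
    (A • onesMat ι + B • (1 : Matrix ι ι ℝ))⁻¹ =
      B⁻¹ • ((1 : Matrix ι ι ℝ) - (A / ((Fintype.card ι : ℝ) * A + B)) • onesMat ι) := by
  set N : ℝ := (Fintype.card ι : ℝ) with hN
  have key : (B⁻¹ • ((1 : Matrix ι ι ℝ) - (A / (N * A + B)) • onesMat ι)) *
      (A • onesMat ι + B • (1 : Matrix ι ι ℝ)) = 1 := by
    rw [Matrix.smul_mul, Matrix.sub_mul, Matrix.one_mul, Matrix.smul_mul, Matrix.mul_add,
      Matrix.mul_smul, Matrix.mul_smul, onesMat_mul_onesMat, Matrix.mul_one]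
    rw [← hN]
    have h1 : A • onesMat ι + B • (1 : Matrix ι ι ℝ) -
        (A / (N * A + B)) • (A • N • onesMat ι + B • onesMat ι) = B • (1 : Matrix ι ι ℝ) := by
      have : (A / (N * A + B)) • (A • N • onesMat ι + B • onesMat ι) = A • onesMat ι := by
        rw [smul_smul A N, ← add_smul, smul_smul]
        congr 1
        rw [div_mul_eq_mul_div, div_eq_iff hNB]
        ring
      rw [this]; abel
    rw [h1, smul_smul, inv_mul_cancel₀ hB, one_smul]
  exact Matrix.inv_eq_left_inv key

/-- KERNEL-CHECKED: the mean in **(3.3)** — the solution of `(A·𝟙𝟙ᵀ + B·1)m = C·𝟙` is the constant vector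
`C/(NA+B)` (second member of (3.3)). [cite: Balaban1983RegularityDecay, (3.3) p.587] -/
theorem gauss33_mean {ι : Type*} [Fintype ι] [DecidableEq ι] (A B C : ℝ) (hB : B ≠ 0) (hNB : (Fintype.card ι : ℝ) * A + B ≠ 0) :
    (A • onesMat ι + B • (1 : Matrix ι ι ℝ))⁻¹ *ᵥ (fun _ => C) =
      fun _ => C / ((Fintype.card ι : ℝ) * A + B) := by
  rw [gauss33_inv A B hB hNB]
  ext i
  simp only [Matrix.smul_mulVec, Matrix.sub_mulVec, Matrix.one_mulVec, Pi.smul_apply, Pi.sub_apply,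
    smul_eq_mul]
  have : (onesMat ι *ᵥ fun _ : ι => C) i = (Fintype.card ι : ℝ) * C := by
    simp [onesMat, Matrix.mulVec, dotProduct]
  rw [this]
  have hNB' : A * (Fintype.card ι : ℝ) + B ≠ 0 := by rwa [mul_comm] at hNB
  field_simp
  ring

end Gauss

/-! ## §1. The operators of §3 as plain real matrices (DICTIONARY above) -/

section Operators

variable {X Y Z : Type*}

/-- `D_S`, the diagonal indicator matrix of a set of sites `S` (the characteristic functions `(Ω∖B^k(Λ))`, `B^k(Λ)`
composed with the block projections in (3.5)). [cite: Balaban1983RegularityDecay, (3.5) p.587] -/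
def diagInd [DecidableEq Y] (S : Finset Y) : Matrix Y Y ℝ :=
  Matrix.diagonal fun y => if y ∈ S then 1 else 0

/-- *"the recursive relation a_{k+1} = aa_k/(aL^{−2} + a_k)"* (p. 587 [PDF 17]), with `ℓ = L^{−2}`; cf. the
kernel-checked `B4.recursion_51` and `B1.aSeq`. [cite: Balaban1983RegularityDecay, (3.3)–(3.4) p.587] -/
noncomputable def aNext (a ak ℓ : ℝ) : ℝ := a * ak / (a * ℓ + ak)

/-- The plain form matrix `K̂ = H + a_k Q_kᵀQ_k` of `−Δ^{η,N}_{A,Ω} + m_k² + a_kP_k(A)` (1.6) (DICTIONARY: `H` = the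
form matrix of `−Δ^{η,N}_{A,Ω} + m_k²`, `Qk` = (1.4) as a plain matrix). [cite: Balaban1983RegularityDecay, (1.6) p.572] -/
def kForm [Fintype Y] (H : Matrix X X ℝ) (ak : ℝ) (Qk : Matrix Y X ℝ) : Matrix X X ℝ :=
  H + ak • (Qkᵀ * Qk)

/-- DICTIONARY LEMMA (no new notion): `B4GaugeCovariance.covOp c m2 a q W T` (the operator of (1.6) with gauge field,
`covLap c W + m2•1 + a•projOp q T`, `projOp = avgOpᵀ avgOp`) IS `kForm (covLap c W + m2•1) a (avgOp q T)`. [cite: Balaban1983RegularityDecay, (1.6) p.572] -/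
theorem kForm_covOp {X Y ι : Type*} [Fintype X] [Fintype Y] [Fintype ι] [DecidableEq X] [DecidableEq ι]
    (c : X → X → ℝ) (m2 a : ℝ) (q : Y → X → ℝ) (W : X → X → Matrix ι ι ℝ) (T : Y → X → Matrix ι ι ℝ) :
    kForm (B4GaugeCovariance.covLap c W + m2 • (1 : Matrix (X × ι) (X × ι) ℝ)) a
      (B4GaugeCovariance.avgOp q T) = B4GaugeCovariance.covOp c m2 a q W T := rfl

/-- The covariance kernel `G_k(Ω,A; x,x')` of (1.6) as a plain matrix: `K̂⁻¹` (Mathlib's nonsingular inverse; the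
true inverse under (1.8)). [cite: Balaban1983RegularityDecay, (1.6) p.572] -/
noncomputable def gk [Fintype X] [Fintype Y] [DecidableEq X] (H : Matrix X X ℝ) (ak : ℝ)
    (Qk : Matrix Y X ℝ) : Matrix X X ℝ :=
  (kForm H ak Qk)⁻¹

/-- **(1.14)** `Δ^{(k)}(Ω,A) = a_kI − a_k²Q_k(A)G_k(Ω,A)Q_k^*(A)` (p. 573 [PDF 3]: *"an operator of the effective
Gaussian action after k renormalization transformations"*) as a plain matrix on the unit lattice (DICTIONARY: the
weights of `G_k` as an operator and of `Q_k^*` cancel). [cite: Balaban1983RegularityDecay, (1.14) p.573] -/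
noncomputable def deltaK [Fintype X] [Fintype Y] [DecidableEq X] [DecidableEq Y] (H : Matrix X X ℝ)
    (ak : ℝ) (Qk : Matrix Y X ℝ) : Matrix Y Y ℝ :=
  ak • (1 : Matrix Y Y ℝ) - ak ^ 2 • (Qk * gk H ak Qk * Qkᵀ)

/-- `P(A) = Q^*(A)Q(A)`, the next-level `L`-block averaging projection on the unit lattice (p. 574; written out at
(5.1) p. 593), as a plain matrix: `w•QᵀQ`, `w = L^d` the weight of the `L`-lattice pairing (DICTIONARY). [cite: Balaban1983RegularityDecay, (1.13) p.573, (5.1) p.593] -/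
def pOp [Fintype Z] (w : ℝ) (Q : Matrix Z Y ℝ) : Matrix Y Y ℝ :=
  w • (Qᵀ * Q)

/-- The operator `(Δ^{(k)}(Ω,A) + aL^{−2}P(A))|_Λ` of **(1.13)** (`X|_Λ = ΛXΛ`, p. 573), `ℓ = L^{−2}`. [cite: Balaban1983RegularityDecay, (1.13) p.573] -/
noncomputable def cOpLam [Fintype X] [Fintype Y] [Fintype Z] [DecidableEq X] [DecidableEq Y]
    (H : Matrix X X ℝ) (ak : ℝ) (Qk : Matrix Y X ℝ) (a ℓ w : ℝ) (Q : Matrix Z Y ℝ)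
    (Λ : Finset Y) : Matrix Λ Λ ℝ :=
  (deltaK H ak Qk + (a * ℓ) • pOp w Q).submatrix Subtype.val Subtype.val

/-- **(1.13)** `C^{(k)}_Λ(Ω,A) = ((Δ^{(k)}(Ω,A) + aL^{−2}P(A))|_Λ)^{−1}`, the unit-lattice propagator of [1] (p. 573
[PDF 3]); its kernel is the covariance of the Gaussian (3.1). [cite: Balaban1983RegularityDecay, (1.13) p.573, (3.1) p.586] -/
noncomputable def cLam [Fintype X] [Fintype Y] [Fintype Z] [DecidableEq X] [DecidableEq Y]
    (H : Matrix X X ℝ) (ak : ℝ) (Qk : Matrix Y X ℝ) (a ℓ w : ℝ) (Q : Matrix Z Y ℝ)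
    (Λ : Finset Y) : Matrix Λ Λ ℝ :=
  (cOpLam H ak Qk a ℓ w Q Λ)⁻¹

/-- `Q_{k+1}(A) = Q(A)Q_k(A)` (the composition rule of the block averages of [1], used in (3.1) line 2 where
`Q(A)(Q_k(A)φ)` is written `Q_{k+1}(A)φ`). [cite: Balaban1983RegularityDecay, (3.1) p.587] -/
def qNext [Fintype Y] (Q : Matrix Z Y ℝ) (Qk : Matrix Y X ℝ) : Matrix Z X ℝ :=
  Q * Qk

/-- The form matrix of **(3.5)**: `K̂_Λ = H + a_k QkᵀD_{Λᶜ}Qk + a_{k+1}wℓ Q_{k+1}ᵀD_{Λ'}Q_{k+1}`, i.e.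
*"G_k(Ω,Λ,A) = (−Δ^{η,N}_{A,Ω} + m_k² + a_kP_k(A)(Ω∖B^k(Λ)) + a_{k+1}L^{−2}P_{k+1}(A)B^k(Λ))^{−1} (3.5)"* before
inversion; `Λ'` = the `L`-lattice points whose block lies in `Λ` (`B^k(Λ) = ⋃_{z∈Λ'}B^{k+1}(z)`). [cite: Balaban1983RegularityDecay, (3.5) p.587] -/
noncomputable def kLam [Fintype Y] [Fintype Z] [DecidableEq Y] [DecidableEq Z] (H : Matrix X X ℝ) (ak : ℝ)
    (Qk : Matrix Y X ℝ) (a ℓ w : ℝ) (Q : Matrix Z Y ℝ) (Λ : Finset Y) (Λ' : Finset Z) : Matrix X X ℝ :=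
  H + ak • (Qkᵀ * diagInd Λᶜ * Qk) + (aNext a ak ℓ * w * ℓ) • ((qNext Q Qk)ᵀ * diagInd Λ' * qNext Q Qk)

/-- **(3.5)** `G_k(Ω,Λ,A)`, the two-scale propagator (unit blocks outside `Λ`, `L`-blocks inside), as the plain
covariance matrix `K̂_Λ⁻¹`. [cite: Balaban1983RegularityDecay, (3.5) p.587] -/
noncomputable def gLam [Fintype X] [Fintype Y] [Fintype Z] [DecidableEq X] [DecidableEq Y]
    [DecidableEq Z] (H : Matrix X X ℝ) (ak : ℝ) (Qk : Matrix Y X ℝ) (a ℓ w : ℝ) (Q : Matrix Z Y ℝ)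
    (Λ : Finset Y) (Λ' : Finset Z) : Matrix X X ℝ :=
  (kLam H ak Qk a ℓ w Q Λ Λ')⁻¹

/-- `G^η_{k+1}(Ω,A)` of (3.9): the case `Λ = Ω^{(k)}` (all unit blocks replaced by `L`-blocks) of (3.5), i.e.
`(−Δ^{η,N}_{A,Ω} + m_k² + a_{k+1}L^{−2}P_{k+1}(A))^{−1}` — the propagator entering `C^{(k)}(Ω,A) = C^{(k)}_{Ω^{(k)}}(Ω,A)`
through (3.8). [cite: Balaban1983RegularityDecay, (3.9) p.588] -/
noncomputable def gNext [Fintype X] [Fintype Y] [Fintype Z] [DecidableEq X] [DecidableEq Y]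
    [DecidableEq Z] (H : Matrix X X ℝ) (ak : ℝ) (Qk : Matrix Y X ℝ) (a ℓ w : ℝ) (Q : Matrix Z Y ℝ) :
    Matrix X X ℝ :=
  gLam H ak Qk a ℓ w Q Finset.univ Finset.univ

/-- The operator `[−(a_{k+1}/a_k)L^{−2}Q^*(A)Q_{k+1}(A) + Q_k(A)]` of **(3.6)**, rows restricted to `y ∈ Λ`
(`Q^* = wQᵀ`, DICTIONARY; the indicator `D_{Λ'}` is redundant for rows in `Λ` under `BlockCompatible` and is kept so
that the definition does not depend on that hypothesis). [cite: Balaban1983RegularityDecay, (3.6) p.588] -/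
noncomputable def tOp [Fintype Y] [Fintype Z] [DecidableEq Z] (ak : ℝ) (Qk : Matrix Y X ℝ) (a ℓ w : ℝ)
    (Q : Matrix Z Y ℝ) (Λ : Finset Y) (Λ' : Finset Z) : Matrix Λ X ℝ :=
  (Qk - (aNext a ak ℓ / ak * w * ℓ) • (Qᵀ * diagInd Λ' * qNext Q Qk)).submatrix Subtype.val id

/-- The right-hand side of **(3.6)**: `TG_k(Ω,Λ,A)Tᵀ − (a_{k+1}/a_k²)L^{−2}P(A)|_Λ + (1/a_k)·1_Λ`. [cite: Balaban1983RegularityDecay, (3.6) p.588] -/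
noncomputable def rep36Rhs [Fintype X] [Fintype Y] [Fintype Z] [DecidableEq X] [DecidableEq Y]
    [DecidableEq Z] (H : Matrix X X ℝ) (ak : ℝ) (Qk : Matrix Y X ℝ) (a ℓ w : ℝ) (Q : Matrix Z Y ℝ)
    (Λ : Finset Y) (Λ' : Finset Z) : Matrix Λ Λ ℝ :=
  tOp ak Qk a ℓ w Q Λ Λ' * gLam H ak Qk a ℓ w Q Λ Λ' * (tOp ak Qk a ℓ w Q Λ Λ')ᵀ
    - (aNext a ak ℓ / ak ^ 2 * ℓ) • (pOp w Q).submatrix Subtype.val Subtype.val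
    + (1 / ak) • (1 : Matrix Λ Λ ℝ)

/-- Structure hypothesis on `Q(A)`: `QQᵀ = w⁻¹·1` — the rows `L^{−d}U(A(Γ_{z,y}))`, `y ∈ B(z)`, of the `L`-block
averaging are pairwise orthogonal with squared norm `L^{−d}` (`L^d` sites per block, orthogonal `U`). [cite: Balaban1983RegularityDecay, (1.4) p.572, (3.2) p.587] -/
def RowOrtho [Fintype Y] [DecidableEq Z] (w : ℝ) (Q : Matrix Z Y ℝ) : Prop :=
  Q * Qᵀ = w⁻¹ • (1 : Matrix Z Z ℝ)

/-- Geometric hypothesis: no `L`-block straddles `∂Λ` — `Λ` is the union of the blocks `B(z)`, `z ∈ Λ'` (*"Λ being a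
sum of big blocks"*, p. 574 [PDF 4]; `Λ'` of (3.1)). [cite: Balaban1983RegularityDecay, Prop. 2.3 of [1] p.574, (3.1) p.586] -/
def BlockCompatible (Q : Matrix Z Y ℝ) (Λ : Finset Y) (Λ' : Finset Z) : Prop :=
  ∀ z y, Q z y ≠ 0 → (y ∈ Λ ↔ z ∈ Λ')

/-- **(3.6)** (p. 588 [PDF 18], verbatim): *"we have finally C^{(k)}_Λ(Ω,A;y,y') = ([−(a_{k+1}/a_k)L^{−2}Q*(A)Q_{k+1}(A)
+ Q_k(A)]G_k(Ω,Λ,A)·[−(a_{k+1}/a_k)L^{−2}Q*_{k+1}(A)Q(A) + Q*_k(A)])(y,y') − (a_{k+1}/a_k²)L^{−2}P(A;y,y') +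
δ_{y,y'}/a_k. (3.6)"* — TYPED as an identity of plain matrices (DICTIONARY), hypotheses explicit: `H` symmetric;
`a_k, a > 0`, `ℓ = L^{−2} > 0`, `w = L^d > 0`; `RowOrtho`, `BlockCompatible`; the forms of `G_k(Ω,A)` (1.6) and of
`G_k(Ω,Λ,A)` (3.5) positive definite ((1.8); under the other hypotheses the second implies the first and the
invertibility of (1.13), by a Schur-complement argument recorded in the module docstring).  Printed derivation:
(3.1)–(3.4) (`GaussCovariance`, translation `ψ → ψ + Q_kφ`, gauge transformation `ψ(y) → U(A(Γ_{y,z}))ψ(y)`, `Gauss33`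
blockwise).  Proof deferred (Phase 2: Woodbury/Schur complement). [cite: Balaban1983RegularityDecay, (3.6) p.588] -/
def Rep36 [Fintype X] [Fintype Y] [Fintype Z] [DecidableEq X] [DecidableEq Y] [DecidableEq Z]
    (H : Matrix X X ℝ) (ak : ℝ) (Qk : Matrix Y X ℝ) (a ℓ w : ℝ) (Q : Matrix Z Y ℝ) (Λ : Finset Y)
    (Λ' : Finset Z) : Prop :=
  H.IsSymm → 0 < ak → 0 < a → 0 < ℓ → 0 < w → RowOrtho w Q → BlockCompatible Q Λ Λ' →
    (kForm H ak Qk).PosDef → (kLam H ak Qk a ℓ w Q Λ Λ').PosDef →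
      cLam H ak Qk a ℓ w Q Λ = rep36Rhs H ak Qk a ℓ w Q Λ Λ'

/-! ### (3.7)–(3.8): the same identity through the functions `q_k(y)`, `q_{k+1}(y)` -/

/-- **(3.7)**, first function: `q_k(y,x) = a column of U(A(Γ^{(k)}_{x,y}))` for `x ∈ B^k(y)`, `0` otherwise — as a plain
vector on `X` paired by the plain dot product, this is the row `y` of `Qk` (the `η^d` of [B4]'s pairing `⟨·,·⟩` is the
`η^d` in `Qk`'s entries; *"The L²-norms of the functions q_k(y) … are equal to 1"*). [cite: Balaban1983RegularityDecay, (3.7) p.588] -/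
def qk (Qk : Matrix Y X ℝ) (y : Y) : X → ℝ := fun x => Qk y x

/-- **(3.7)**, second function: `q_{k+1}(y,x) = a column of L^{−d}U(A(Γ^{(k+1)}_{x,z}∪Γ_{z,y}))` for `x ∈ B^{k+1}(z)`, `z`
such that `y ∈ B(z)`, `0` otherwise — the row `y` of `Q^*(A)Q_{k+1}(A) = wQᵀQ_{k+1}` (norm `L^{−d/2}`; the indicator
`D_{Λ'}` is inserted as in `tOp`). [cite: Balaban1983RegularityDecay, (3.7) p.588] -/
def qk1 [Fintype Y] [Fintype Z] [DecidableEq Z] (Qk : Matrix Y X ℝ) (w : ℝ) (Q : Matrix Z Y ℝ)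
    (Λ' : Finset Z) (y : Y) : X → ℝ :=
  fun x => (w • (Qᵀ * diagInd Λ' * qNext Q Qk)) y x

/-- The rows of `tOp` are the vectors `−(a_{k+1}/a_k)L^{−2}q_{k+1}(y) + q_k(y)` of (3.8). [cite: Balaban1983RegularityDecay, (3.7)–(3.8) p.588] -/
theorem tOp_row [Fintype Y] [Fintype Z] [DecidableEq Z] (ak : ℝ) (Qk : Matrix Y X ℝ) (a ℓ w : ℝ)
    (Q : Matrix Z Y ℝ) (Λ : Finset Y) (Λ' : Finset Z) (y : Λ) (x : X) :
    tOp ak Qk a ℓ w Q Λ Λ' y x = -(aNext a ak ℓ / ak * ℓ) * qk1 Qk w Q Λ' y x + qk Qk y x := by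
  simp only [tOp, qk1, qk, Matrix.submatrix_apply, id_eq, Matrix.sub_apply, Matrix.smul_apply, smul_eq_mul]
  ring

/-- **(3.8)** (p. 588 [PDF 18], verbatim): *"then we have C^{(k)}_Λ(Ω,A;y,y') = ⟨−(a_{k+1}/a_k)L^{−2}q_{k+1}(y) + q_k(y),
G_k(Ω,Λ,A)(−(a_{k+1}/a_k)L^{−2}q_{k+1}(y') + q_k(y'))⟩ − (a_{k+1}/a_k²)L^{−2}P(A;y,y') + δ_{y,y'}/a_k. (3.8)"* —
KERNEL-CHECKED as the entrywise reading of (3.6): for every family satisfying `Rep36`'s conclusion the kernel of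
`C^{(k)}_Λ` is the printed pairing. [cite: Balaban1983RegularityDecay, (3.8) p.588] -/
theorem eq38 [Fintype X] [Fintype Y] [Fintype Z] [DecidableEq X] [DecidableEq Y] [DecidableEq Z]
    (H : Matrix X X ℝ) (ak : ℝ) (Qk : Matrix Y X ℝ) (a ℓ w : ℝ) (Q : Matrix Z Y ℝ) (Λ : Finset Y)
    (Λ' : Finset Z) (h36 : cLam H ak Qk a ℓ w Q Λ = rep36Rhs H ak Qk a ℓ w Q Λ Λ') (y y' : Λ) :
    cLam H ak Qk a ℓ w Q Λ y y' =
      (fun x => -(aNext a ak ℓ / ak * ℓ) * qk1 Qk w Q Λ' y x + qk Qk y x) ⬝ᵥ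
          (gLam H ak Qk a ℓ w Q Λ Λ' *ᵥ
            fun x => -(aNext a ak ℓ / ak * ℓ) * qk1 Qk w Q Λ' y' x + qk Qk y' x)
        - aNext a ak ℓ / ak ^ 2 * ℓ * pOp w Q y y' + (if y = y' then 1 / ak else 0) := by
  have hrow : ∀ z : Λ, (fun x => -(aNext a ak ℓ / ak * ℓ) * qk1 Qk w Q Λ' z x + qk Qk z x) =
      fun x => tOp ak Qk a ℓ w Q Λ Λ' z x := by
    intro z; funext x; rw [tOp_row]
  rw [h36, hrow y, hrow y', rep36Rhs]
  simp only [Matrix.add_apply, Matrix.sub_apply, Matrix.smul_apply, Matrix.submatrix_apply, smul_eq_mul,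
    Matrix.one_apply, mul_ite, mul_one, mul_zero]
  congr 1
  congr 1
  simp only [Matrix.mul_apply, Matrix.transpose_apply, dotProduct, Matrix.mulVec, Finset.sum_mul,
    Finset.mul_sum]
  rw [Finset.sum_comm]
  exact Finset.sum_congr rfl fun x _ => Finset.sum_congr rfl fun x' _ => by ring

/-! ### (3.9): the resolvent identity (correct sign) and (3.10) -/

/-- The perturbation `[a_kP_k(A) − a_{k+1}L^{−2}P_{k+1}(A)](Ω∖B^k(Λ))` of **(3.9)** as a plain form matrix: unit
blocks outside `Λ` minus `L`-blocks outside `Λ'`. [cite: Balaban1983RegularityDecay, (3.9) p.588] -/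
noncomputable def vOut [Fintype Y] [Fintype Z] [DecidableEq Y] [DecidableEq Z] (ak : ℝ) (Qk : Matrix Y X ℝ)
    (a ℓ w : ℝ)
    (Q : Matrix Z Y ℝ) (Λ : Finset Y) (Λ' : Finset Z) : Matrix X X ℝ :=
  ak • (Qkᵀ * diagInd Λᶜ * Qk) - (aNext a ak ℓ * w * ℓ) • ((qNext Q Qk)ᵀ * diagInd Λ'ᶜ * qNext Q Qk)

/-- The two form matrices of (3.5) differ by `vOut`: `K̂_Λ − K̂_{Ω^{(k)}} = [a_kP_k − a_{k+1}L^{−2}P_{k+1}](Ω∖B^k(Λ))`. [cite: Balaban1983RegularityDecay, (3.5), (3.9) pp.587–588] -/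
theorem kLam_sub_kLam_univ [Fintype Y] [Fintype Z] [DecidableEq Y] [DecidableEq Z] (H : Matrix X X ℝ)
    (ak : ℝ) (Qk : Matrix Y X ℝ) (a ℓ w : ℝ) (Q : Matrix Z Y ℝ) (Λ : Finset Y) (Λ' : Finset Z) :
    kLam H ak Qk a ℓ w Q Λ Λ' - kLam H ak Qk a ℓ w Q Finset.univ Finset.univ =
      vOut ak Qk a ℓ w Q Λ Λ' := by
  have h1 : diagInd (Finset.univ : Finset Y)ᶜ = (0 : Matrix Y Y ℝ) := by
    ext i j; simp [diagInd, Matrix.diagonal_apply]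
  have h2 : diagInd (Finset.univ : Finset Z) = (1 : Matrix Z Z ℝ) := by
    ext i j; simp [diagInd, Matrix.diagonal_apply, Matrix.one_apply]
  have h3 : diagInd Λ'ᶜ = (1 : Matrix Z Z ℝ) - diagInd Λ' := by
    ext i j
    by_cases hij : i = j
    · subst hij; by_cases hi : i ∈ Λ' <;> simp [diagInd, hi]
    · simp [diagInd, hij]
  simp only [kLam, vOut, h1, h2, h3, Matrix.mul_zero, Matrix.zero_mul, smul_zero, add_zero, Matrix.mul_one,
    Matrix.mul_sub, Matrix.sub_mul, smul_sub]
  abel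

/-- **(3.9) with the correct sign** (KERNEL-CHECKED): whenever both propagators exist,
`G_k(Ω,Λ,A) − G^η_{k+1}(Ω,A) = −G_k(Ω,Λ,A)[a_kP_k(A) − a_{k+1}L^{−2}P_{k+1}(A)](Ω∖B^k(Λ))G^η_{k+1}(Ω,A)` — the second
resolvent identity `A⁻¹ − B⁻¹ = A⁻¹(B − A)B⁻¹` with `B − A = −vOut`.  The print, *"G_k(Ω,Λ,A) − G^η_{k+1}(Ω,A) =
G_k(Ω,Λ,A)[a_kP_k(A) − a_{k+1}L^{−2}P_{k+1}(A)](Ω∖B^k(Λ))G^η_{k+1}(Ω,A), (3.9)"*, omits the overall minus sign (print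
slip; immaterial for (3.10), which estimates an absolute value). [cite: Balaban1983RegularityDecay, (3.9) p.588] -/
theorem eq39 [Fintype X] [Fintype Y] [Fintype Z] [DecidableEq X] [DecidableEq Y] [DecidableEq Z]
    (H : Matrix X X ℝ) (ak : ℝ) (Qk : Matrix Y X ℝ) (a ℓ w : ℝ) (Q : Matrix Z Y ℝ) (Λ : Finset Y)
    (Λ' : Finset Z) (hΛ : IsUnit (kLam H ak Qk a ℓ w Q Λ Λ'))
    (hf : IsUnit (kLam H ak Qk a ℓ w Q Finset.univ Finset.univ)) :
    gLam H ak Qk a ℓ w Q Λ Λ' - gNext H ak Qk a ℓ w Q =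
      -(gLam H ak Qk a ℓ w Q Λ Λ' * vOut ak Qk a ℓ w Q Λ Λ' * gNext H ak Qk a ℓ w Q) := by
  unfold gNext gLam
  rw [Matrix.inv_sub_inv (iff_of_true hΛ hf), ← neg_sub, kLam_sub_kLam_univ]
  simp

/-- **(3.10)** (p. 589 [PDF 19], verbatim): *"and for f, f' ∈ L²(B^k(Λ)), we get |⟨f,(G_k(Ω,Λ,A) − G^η_{k+1}(Ω,A))f'⟩| ≤
c₀‖f‖₂‖f'‖₂·exp[−δ₀(dist(supp f,supp f') + dist(supp f,B^k(Λ^c)) + dist(supp f',B^k(Λ^c)))]. (3.10)"* — typed for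
one instance with constants `(c₀, δ₀)` over the printed functionals supplied by the instantiation: `Gd` = the plain
matrix of `G_k(Ω,Λ,A) − G^η_{k+1}(Ω,A)` in [B4]'s pairing, `nrm` = `‖·‖₂`, `sdist S S'` = the lattice distance of two site
sets, `bkΛc` = the site set `B^k(Λ^c)` (`Λ^c` the complement of `Λ` in `Ω^{(k)}`), `bkΛ` = `B^k(Λ)`.  Printed proof:
(3.9) + Corollary 2.3 (`B4.Cor23Printed`) for both factors (census of the audit cell: routine two-propagator
convolution of exponential bounds). [cite: Balaban1983RegularityDecay, (3.10) p.589] -/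
def Ineq310 [Fintype X] (Gd : Matrix X X ℝ) (nrm : (X → ℝ) → ℝ) (sdist : Finset X → Finset X → ℝ) (bkΛ bkΛc : Finset X)
    (c₀ δ₀ : ℝ) : Prop :=
  ∀ (f f' : X → ℝ) (S S' : Finset X), S ⊆ bkΛ → S' ⊆ bkΛ → (∀ x ∉ S, f x = 0) → (∀ x ∉ S', f' x = 0) →
    |f ⬝ᵥ (Gd *ᵥ f')| ≤
      c₀ * nrm f * nrm f' * Real.exp (-(δ₀ * (sdist S S' + sdist S bkΛc + sdist S' bkΛc)))

end Operators

end Literature.MathematicalPhysics.QuantumFieldTheory.Balaban1983to89.B4GaussRep36
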